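/-
Copyright: the b2b-balaban T⁴-continuum CRUX team, row NE7b owner lineage `t4-ne7b-p1` (gen 116). Project licence.
-/
import Summits.QuantumFields.BalabanUV.T4Continuum.Spine.NE7b.SupInductiveStepLattice

/-!
# THE SMALL-FIELD BACKGROUND OF LATTICE `φ⁴` IN THE SUP CURRENCY: for the sitewise term `u(t) = g·t³ + m·t` (the derivative of the
# potential `v(t) = (g∕4)t⁴ + (m∕2)t²`) on `ℤ^d`, `d ≥ 3`, every block side `n + 1`, the local Nemytskii letters hold on the field
# window `|t| ≤ ρ` with `λ = 3|g|ρ² + |m|`, `L = 6|g|ρ`; so for every chart constant `N ≥ N_∞` and every smallness margin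
# `2(3|g|ρ² + |m|) ≤ c < N⁻¹` — WEAK COUPLING OR SMALL FIELDS — leaf-04's `ℓ^∞` inductive step delivers the background branch `σ` on
# the chart ball `‖w‖ ≤ (N⁻¹ − c)·r` (`r < ρ`) with the lift identity, the Lipschitz letter `(N⁻¹ − c)⁻¹`, uniqueness, and the next
# equation map's derivative (row NE7b, node U5c; SISL §3 BY NAME on a concrete potential; [folklore])

Cell `pub-balaban`, sub-cell `t4`, spine estimate NE7b (`T4WeightBudget.RelWeightBound`; the cell's OWN estimate — NOT PRINTED in
[Bałaban 1983–89], NOT PROVED).  Crux-route work under `Spine/NE7b/` by the row OWNER (`t4-ne7b-p1` gen 116) under FREEZE (0)'s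
crux-prover clause (FILING-CLAIM C-ne7bp1-g116-11); NOTHING of Bałaban's is named, valued or asserted; no `T4Continuum/Support` leaf
typed; no `def`, no notation; zero `sorry`.  Imports (BY NAME): leaf-04's `…SupInductiveStepLattice`
(`inductiveStep_lattice_of_nemytskii_ball` — SIS ∕ ASE ∕ (60) §1 ∕ LNSB by name).

WHY (located).  Every file of the sup road since (58) carries the interaction as DATA: a sitewise `u` with `u 0 = 0` and letters
`(λ, L)` on `ℝ` ((58), (60)) or on a window `|t| ≤ ρ` (leaf-04's LNSB ∕ SISL §3).  The model the road is FOR — the scalar caricature of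
print's small-field problem — is the lattice `φ⁴_d` action `Σ_x [½|∇^ηφ|² + (m∕2)φ² + (g∕4)φ⁴]` with the block-average constraint, whose
sitewise term `u = v′ = g·t³ + m·t` has UNBOUNDED derivative: only the window letters apply, and they hold with `λ = 3|g|ρ² + |m|`,
`L = 6|g|ρ` (§1, school calculus).  THIS FILE makes the instance a tree statement: the small-field condition of the sup road for `φ⁴_d` is
the displayed inequality `2(3|g|ρ² + |m|) ≤ c < N⁻¹` between the coupling, the mass, the field window and the chart constant (§2), i.e.
for any window `ρ` the background exists for all couplings `|g| < (N⁻¹ − 2|m|)∕(6ρ²)`, and for any coupling for all windows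
`ρ² < (N⁻¹ − 2|m|)∕(6|g|)` (§3, the window in closed form).

WHAT IS PROVED ([folklore]):
* §1 `hasDerivAt_phiFour` (`u′(t) = 3g t² + m`), `phiFour_zero`, `abs_deriv_phiFour_le` (`|u′ t| ≤ 3|g|ρ² + |m|` on `|t| ≤ ρ`),
  `abs_deriv_phiFour_sub_le` (`|u′ s − u′ t| ≤ 6|g|ρ·|s − t|` on the window).
* §2 **`exists_phiFour_background`** — `d ≥ 3`, side `n + 1`, `a > 0`, `g m : ℝ`, window `ρ ≥ 0`, `λ ≥ 3|g|ρ² + |m|`, `N ≥ N_∞`,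
  `2λ ≤ c < N⁻¹`, `0 ≤ r < ρ` ⟹ SISL §3's conclusion VERBATIM with `Nu φ i = g·(φ i)³ + m·(φ i)` displayed: the operators `Q′, A, P, Lp`,
  the branch `σ` with `σ 0 = 0`, on `‖w‖ ≤ (N⁻¹ − c)r`: `‖σ w‖ ≤ r`, `Q′(σ w) = w`, `P(A(σ w) + u∘σ w) = 0`, the lift identity; the
  Lipschitz letter; uniqueness; the next equation map's derivative and bound; zeros lift.
* §3 `phiFour_window` (the smallness in closed form: `6|g|ρ² + 2|m| < N⁻¹` ⟹ the margin `c := 2(3|g|ρ² + |m|)` is admissible).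
* §4 toy: `g = 1∕100`, `m = 0`, `ρ = 1`, `N = 4`: `6|g|ρ² = 3∕50 < 1∕4`.

HONEST (what this is NOT).  The small-field problem of a scalar caricature: no large fields, no fluctuation integral, no flow of `(g, m)`
(print renormalises both), constants `N_∞(d, a)` existential and useless by value at small sides (leaf-03's TCS2 ∕ TCS3); the weighted ∕
gradient ∕ region letters of the road are typed for GLOBAL letters ((60)) and are not re-derived on the window here; nothing of the
covariant `H_k`, (A3) ∕ (A1c) (NC-NE7b-α UNRULED).  BY-NAME EFFECT ON THE WALL: NONE.  NE7b NOT PRINTED ∕ NOT PROVED; spine PROVED 0∕9;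
rung (B)+1 on a FINITE torus — NOT infinite volume, NOT the mass gap, NOT Clay.  HONEST DEPENDENCY: continuum YM on T⁴ ⇐ BetaPertH ∧
nine spine estimates (0∕9 proved); BetaPertH ⇐ (D1) ∧ (D4) ∧ CAP+tail; G-an2-4 gates asym, D1 and NE2∕3∕4.
-/

set_option autoImplicit false

noncomputable section

namespace Summit.QuantumFields.BalabanUV.T4Continuum.NE7b.SupPhiFourBackground

open scoped ENNReal NNReal
open Metric Set
open Literature.MathematicalPhysics.QuantumFieldTheory.Balaban1983to89
open B4Sect5Proof (latticeConst latticeConst_nonneg)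
open B6QGQLower276 (X blk B AX)
open B6QGQDecay237 (deltaU deltaU_pos)
open B5Hk103ScalarZd (nbhd deltaH deltaH_pos)
open Summit.QuantumFields.BalabanUV.Beta.D1BFx.BlockColumnSupNorm (cHs cHs_nonneg)
open Summit.QuantumFields.BalabanUV.Beta.D1BFx.PointColumnSplit (cKL cG0 cSplit)
open Summit.QuantumFields.BalabanUV.Beta.D1BFx.PointColumnDecay (cFar)
open SupInductiveStepLattice (inductiveStep_lattice_of_nemytskii_ball)

variable {d : ℕ}

/-! ## §1. The calculus letters of `u(t) = g t³ + m t` on the window `|t| ≤ ρ` -/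

/-- `u(t) = g·t³ + m·t` has derivative `3g·t² + m`. [folklore] -/
theorem hasDerivAt_phiFour (g m t : ℝ) : HasDerivAt (fun t : ℝ => g * t ^ 3 + m * t) (3 * g * t ^ 2 + m) t := by
  have h1 : HasDerivAt (fun t : ℝ => g * t ^ 3) (g * ((3 : ℕ) * t ^ (3 - 1))) t := (hasDerivAt_pow 3 t).const_mul g
  have h2 : HasDerivAt (fun t : ℝ => m * t) (m * 1) t := (hasDerivAt_id' t).const_mul m
  refine (h1.add h2).congr_deriv ?_
  push_cast
  ring

/-- `u(0) = 0`. [folklore] -/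
theorem phiFour_zero (g m : ℝ) : (fun t : ℝ => g * t ^ 3 + m * t) 0 = 0 := by simp

/-- On the window `|t| ≤ ρ`: `|u′(t)| ≤ 3|g|ρ² + |m|`. [folklore] -/
theorem abs_deriv_phiFour_le (g m : ℝ) {ρ t : ℝ} (ht : |t| ≤ ρ) : |3 * g * t ^ 2 + m| ≤ 3 * |g| * ρ ^ 2 + |m| := by
  have hρ : 0 ≤ ρ := (abs_nonneg t).trans ht
  have ht2 : t ^ 2 ≤ ρ ^ 2 := by
    rw [← sq_abs t]; exact pow_le_pow_left₀ (abs_nonneg t) ht 2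
  calc |3 * g * t ^ 2 + m| ≤ |3 * g * t ^ 2| + |m| := abs_add_le _ _
    _ = 3 * |g| * t ^ 2 + |m| := by rw [abs_mul, abs_mul, abs_of_pos (by norm_num : (0:ℝ) < 3), abs_of_nonneg (sq_nonneg t)]
    _ ≤ 3 * |g| * ρ ^ 2 + |m| := by gcongr

/-- On the window: `|u′(s) − u′(t)| ≤ 6|g|ρ·|s − t|` (`3g(s² − t²) = 3g(s + t)(s − t)`, `|s + t| ≤ 2ρ`). [folklore] -/
theorem abs_deriv_phiFour_sub_le (g m : ℝ) {ρ s t : ℝ} (hs : |s| ≤ ρ) (ht : |t| ≤ ρ) :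
    |(3 * g * s ^ 2 + m) - (3 * g * t ^ 2 + m)| ≤ 6 * |g| * ρ * |s - t| := by
  have e : (3 * g * s ^ 2 + m) - (3 * g * t ^ 2 + m) = 3 * g * (s + t) * (s - t) := by ring
  rw [e, abs_mul, abs_mul, abs_mul, abs_of_pos (by norm_num : (0:ℝ) < 3)]
  have hst : |s + t| ≤ 2 * ρ := (abs_add_le _ _).trans (by linarith)
  have h1 : 3 * |g| * |s + t| ≤ 3 * |g| * (2 * ρ) := mul_le_mul_of_nonneg_left hst (by positivity)
  calc 3 * |g| * |s + t| * |s - t| ≤ 3 * |g| * (2 * ρ) * |s - t| := mul_le_mul_of_nonneg_right h1 (abs_nonneg _)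
    _ = 6 * |g| * ρ * |s - t| := by ring

/-! ## §2. The background of lattice `φ⁴` -/

/-- **THE SMALL-FIELD BACKGROUND OF LATTICE `φ⁴_d` IN THE SUP CURRENCY** (`d ≥ 3`, side `n + 1`, `a > 0`; coupling `g`, mass `m`,
field window `ρ ≥ 0`; `λ ≥ 3|g|ρ² + |m|`, `N ≥ N_∞`, `2λ ≤ c < N⁻¹`, `0 ≤ r < ρ`): leaf-04's `inductiveStep_lattice_of_nemytskii_ball` for
`u(t) = g·t³ + m·t` — the Nemytskii map `Nu φ i = g(φ i)³ + m(φ i)`, the operators `Q′, A, P, Lp` with displayed actions, and the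
background branch `σ` with `σ 0 = 0`; on `‖w‖ ≤ (N⁻¹ − c)r`: `‖σ w‖ ≤ r`, `Q′(σ w) = w`, `P(A(σ w) + Nu(σ w)) = 0` and the lift identity;
`(N⁻¹ − c)⁻¹`-Lipschitz; uniqueness in the `r`-ball; the next equation map vanishes at `0`, is differentiable on the open ball with
derivative `Q′∘(A + N′(σ w))∘Dσ(w)` of norm `≤ ‖Q′‖(‖A‖ + λ)(N⁻¹ − c)⁻¹`; zeros lift. [folklore] -/
theorem exists_phiFour_background (hd : 3 ≤ d) (n : ℕ) {a : ℝ} (ha : 0 < a) (g m : ℝ) {ρ : ℝ} (hρ : 0 ≤ ρ)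
    {lam c N : ℝ≥0} (hlam : 3 * |g| * ρ ^ 2 + |m| ≤ lam)
    (hN : cHs d a * latticeConst d (deltaH d a)
        + ((cG0 d * cKL d (d - 2) + cSplit d a) * Real.exp (2 * deltaU d a)
            + cFar d a * Real.exp (4 * deltaU d a) / deltaU d a ^ 2) * latticeConst d (deltaU d a / 4)
          * (1 + cHs d a * latticeConst d (deltaH d a)) ≤ (N : ℝ))
    (hc : 2 * lam ≤ c) (hcN : c < N⁻¹) {r : ℝ} (hr : 0 ≤ r) (hrρ : r < ρ) :
    ∃ (Nu : lp (fun _ : X d => ℝ) ∞ → lp (fun _ : X d => ℝ) ∞)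
      (N' : lp (fun _ : X d => ℝ) ∞ → (lp (fun _ : X d => ℝ) ∞ →L[ℝ] lp (fun _ : X d => ℝ) ∞))
      (Dop Aop Pop Lp : lp (fun _ : X d => ℝ) ∞ →L[ℝ] lp (fun _ : X d => ℝ) ∞)
      (σ : lp (fun _ : X d => ℝ) ∞ → lp (fun _ : X d => ℝ) ∞),
      (∀ (φ : lp (fun _ : X d => ℝ) ∞) (i : X d), Nu φ i = g * (φ i) ^ 3 + m * (φ i)) ∧
      (∀ (f : lp (fun _ : X d => ℝ) ∞) (y : X d), Dop f y = (((n : ℝ) + 1) ^ d)⁻¹ * ∑ p ∈ B n y, f p) ∧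
      (∀ (f : lp (fun _ : X d => ℝ) ∞) (p : X d), Aop f p = ∑ r ∈ nbhd n p, AX n a p r * f r) ∧
      (∀ (f : lp (fun _ : X d => ℝ) ∞) (p : X d), Pop f p = f p - (((n : ℝ) + 1) ^ d)⁻¹ * ∑ p' ∈ B n (blk n p), f p') ∧
      (∀ (f : lp (fun _ : X d => ℝ) ∞) (p : X d), Lp f p = f (blk n p)) ∧
      σ 0 = 0 ∧
      (∀ w ∈ closedBall (0 : lp (fun _ : X d => ℝ) ∞) (((N : ℝ)⁻¹ - c) * r),
        σ w ∈ closedBall (0 : lp (fun _ : X d => ℝ) ∞) r ∧ Dop (σ w) = w ∧ Pop (Aop (σ w) + Nu (σ w)) = 0 ∧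
          Aop (σ w) + Nu (σ w) = Lp (Dop (Aop (σ w) + Nu (σ w)))) ∧
      LipschitzOnWith (N⁻¹ - c)⁻¹ σ (closedBall (0 : lp (fun _ : X d => ℝ) ∞) (((N : ℝ)⁻¹ - c) * r)) ∧
      (∀ x ∈ closedBall (0 : lp (fun _ : X d => ℝ) ∞) r, Pop (Aop x + Nu x) = 0 → σ (Dop x) = x) ∧
      Dop (Aop (σ 0) + Nu (σ 0)) = 0 ∧
      (∀ w ∈ ball (0 : lp (fun _ : X d => ℝ) ∞) (((N : ℝ)⁻¹ - c) * r),
        HasFDerivAt (fun w => Dop (Aop (σ w) + Nu (σ w))) (Dop.comp ((Aop + N' (σ w)).comp (fderiv ℝ σ w))) w ∧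
          ‖Dop.comp ((Aop + N' (σ w)).comp (fderiv ℝ σ w))‖ ≤ ‖Dop‖ * (‖Aop‖ + lam) * ((N : ℝ)⁻¹ - c)⁻¹) ∧
      (∀ w ∈ closedBall (0 : lp (fun _ : X d => ℝ) ∞) (((N : ℝ)⁻¹ - c) * r),
        Dop (Aop (σ w) + Nu (σ w)) = 0 → Aop (σ w) + Nu (σ w) = 0) := by
  have hlam' : ∀ t, |t| ≤ ρ → |3 * g * t ^ 2 + m| ≤ (lam : ℝ) := fun t ht => (abs_deriv_phiFour_le g m ht).trans hlam
  have hL0 : (0 : ℝ) ≤ 6 * |g| * ρ := by positivity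
  have hL : ∀ s t, |s| ≤ ρ → |t| ≤ ρ → |(3 * g * s ^ 2 + m) - (3 * g * t ^ 2 + m)| ≤ 6 * |g| * ρ * |s - t| :=
    fun s t hs ht => abs_deriv_phiFour_sub_le g m hs ht
  obtain ⟨Nu, N', Dop, Aop, Pop, Lp, σ, hNapp, hD, hA, hP, hLp, hσ0, hσ, hlip, huniq, hc0, hcd, hzero⟩ :=
    inductiveStep_lattice_of_nemytskii_ball hd n ha (hasDerivAt_phiFour g m) (phiFour_zero g m) hlam' hL0 hL hN hc hcN hr hrρ
  exact ⟨Nu, N', Dop, Aop, Pop, Lp, σ, hNapp, hD, hA, hP, hLp, hσ0, hσ, hlip, huniq, hc0, hcd, hzero⟩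

/-! ## §3. The window in closed form -/

/-- **THE SMALL-FIELD WINDOW OF `φ⁴_d` IN CLOSED FORM**: if `6|g|ρ² + 2|m| < N⁻¹` then the margin `c := 2(3|g|ρ² + |m|)` satisfies
`2λ ≤ c < N⁻¹` with `λ := 3|g|ρ² + |m|` — for every window `ρ` all couplings `|g| < (N⁻¹ − 2|m|)∕(6ρ²)` are admissible. [folklore] -/
theorem phiFour_window (g m ρ : ℝ) {N : ℝ≥0} (h : 6 * |g| * ρ ^ 2 + 2 * |m| < (N : ℝ)⁻¹) :
    ∃ lam c : ℝ≥0, (lam : ℝ) = 3 * |g| * ρ ^ 2 + |m| ∧ 2 * lam ≤ c ∧ c < N⁻¹ := by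
  have h0 : 0 ≤ 3 * |g| * ρ ^ 2 + |m| := by positivity
  have h0' : 0 ≤ 2 * (3 * |g| * ρ ^ 2 + |m|) := by positivity
  refine ⟨(3 * |g| * ρ ^ 2 + |m|).toNNReal, (2 * (3 * |g| * ρ ^ 2 + |m|)).toNNReal, Real.coe_toNNReal _ h0, ?_, ?_⟩
  · rw [← NNReal.coe_le_coe, NNReal.coe_mul, NNReal.coe_ofNat, Real.coe_toNNReal _ h0, Real.coe_toNNReal _ h0']
  · rw [← NNReal.coe_lt_coe, NNReal.coe_inv, Real.coe_toNNReal _ h0']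
    linarith

/-! ## §4. Toy -/

/-- Toy: `g = 1∕100`, `m = 0`, window `ρ = 1`, chart constant `N = 4`: `6|g|ρ² + 2|m| = 3∕50 < 1∕4 = N⁻¹`, so the margin
`c = 3∕50` is admissible and the chart ball has radius factor `N⁻¹ − c = 19∕100`. -/
example : 6 * |(1 / 100 : ℝ)| * 1 ^ 2 + 2 * |(0 : ℝ)| < (4 : ℝ)⁻¹ ∧ (4 : ℝ)⁻¹ - 3 / 50 = 19 / 100 := by
  rw [abs_of_pos (by norm_num : (0:ℝ) < 1 / 100), abs_zero]; norm_num

end Summit.QuantumFields.BalabanUV.T4Continuum.NE7b.SupPhiFourBackground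

end
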